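import Mathlib
import HarnessLib
import Summits.RiemannHypothesis.RiemannHypothesis.Theses.WeilParity
import Literature.NumberTheory.LFunctions.WeilGroundEnergyParitySplit
import Summits.RiemannHypothesis.RiemannHypothesis.Theorems.WeilGroundStateGroundStateSimpleEvenArch

/-!
# Line `simple-even-halving` — the crux `EvenWinsArch` (stmt-RiemannHypothesis-15433) from the
# LANDED archimedean-window theorem of the sibling crux `GroundStateSimpleEven`

Route `WeilParity` (route-RiemannHypothesis-WeilParity), crux `EvenWinsArch` (rank 4, RH-free):
for every prime-free window `0 < a ≤ (log 2)/2`, every odd `L²`-normalised Weil test `o` on `[-a, a]`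
is matched up to any `δ > 0` by an even normalised one, `Re Q(e) ≤ Re Q(o) + δ`.

## THE LINE = TRANSFER FROM THE SOLVED SIBLING (strategist lens `transfer`)

The sibling crux `GroundStateSimpleEven` (stmt-RiemannHypothesis-1526, route `WeilGroundState`), line
`parity-multiplicity-commutator`, LANDED (p145580, 2026-08-17) the tree theorem

  `Summit.RiemannHypothesis.RiemannHypothesis.Theorems.stub_archimedeanWindows :
      ∀ a : ℝ, 0 < a → a ≤ Real.log 2 / 2 → WeilWindowSimpleEven a`

(Connes–van Suijlekom's "lowest eigenvalue simple and even" clause on EVERY archimedean window: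
parabola Rayleigh quotient `−log a + V(a)` against the Fourier-bathtub odd floor `−log a + L` on
`(0, 7/25]`, cell transfer with the kernel-checked odd bound `1/20` on `[7/25, (log 2)/2]`; a 17-file
certified evaluation chain, all sorry-free in `Theorems/WeilGroundStateGroundStateSimpleEvenArch*.lean`).

`WeilWindowSimpleEven a` is STRONGER than the crux at the window `a`: its odd branch says
`ε(a) + δ₀ ≤ Re Q(o)` for every odd normalised `o` (some `δ₀ > 0`), hence `ε(a) + δ₀ ≤ ε_od(a)`
(`le_weilOddGroundEnergy_of_forall`), hence by `ε = min(ε_ev, ε_od)`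
(`weilGroundEnergy_eq_min_even_odd`) the even bottom is the global one, `ε_ev(a) = ε(a) < ε_od(a)`,
and the matching form follows by `csInf`-approximation on the nonempty even sphere
(`weilWindowSphereValues_even_nonempty`). This file carries that glue out: it is SORRY-FREE and
concludes the crux BY NAME (`EvenWinsArch_of`).

Stubs (both PROVED here; kept as named theorems so the line has the registered two-piece shape):
* `stub_archWindowsSimpleEven` — the sibling's theorem, verbatim (`exact stub_archimedeanWindows`);
* `stub_evenWinsAt_of_le` — ORDER ⇒ MATCHING glue at one window: `ε_ev(a) ≤ ε_od(a) →` the crux's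
  matching form at the window `a` (for `a > 0`); in between, the halving step
  `WeilWindowSimpleEven a → ε_ev(a) < ε_od(a)` (`weilEvenGroundEnergy_lt_odd_of_simpleEven`; the same
  lemma is in the tree as `Theorems.EvenWinsBeyondArch.weilEvenGroundEnergy_lt_weilOddGroundEnergy_of_weilWindowSimpleEven`,
  Theorems/WeilParityEvenWinsBeyondArchSplit.lean).

Disproof.lean for this crux: none exists (`ledger crux ls`, 2026-08-17T08:30Z). Negatives index: one
unrelated entry (UniversalFactor.LaplaceLoophole). The registered line `birth` (parity ladder by
dilation transport, lead prover-line-stmt-RiemannHypothesis-15433-0) is untouched; this line makes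
its remaining stubs (stub_bumpData, stub_logLadder, stub_midLadder, stub_topLadder) unnecessary for
the crux.
-/

set_option linter.dupNamespace false
set_option linter.unusedVariables false

noncomputable section

namespace Summit.RiemannHypothesis.RiemannHypothesis.Cruxes.EvenWinsArch.SimpleEvenHalving

open Set MeasureTheory
open Literature.NumberTheory.LFunctions
open Summit.RiemannHypothesis.RiemannHypothesis.Theses.WeilParity

/-- **Stub 1 — the archimedean windows are simple-and-even (IN THE TREE).** For every
`0 < a ≤ (log 2)/2`, `WeilWindowSimpleEven a`: the sibling crux `GroundStateSimpleEven`'s landed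
theorem `stub_archimedeanWindows` (p145580). [folklore] -/
theorem stub_archWindowsSimpleEven :
    ∀ a : ℝ, 0 < a → a ≤ Real.log 2 / 2 → WeilWindowSimpleEven a :=
  Summit.RiemannHypothesis.RiemannHypothesis.Theorems.stub_archimedeanWindows

/-- **Odd-sector gap from the window clause**: `WeilWindowSimpleEven a` (with `a > 0`) gives a
`δ₀ > 0` with `ε(a) + δ₀ ≤ ε_od(a)` (its odd branch, then `le_weilOddGroundEnergy_of_forall`).
[cite: ConnesSuijlekom2025, Thm. 6.1 (hypothesis), proof p. 11] -/
theorem exists_gap_of_simpleEven {a : ℝ} (ha : 0 < a) (hS : WeilWindowSimpleEven a) :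
    ∃ δ₀ : ℝ, 0 < δ₀ ∧ weilGroundEnergy a + δ₀ ≤ weilOddGroundEnergy a := by
  obtain ⟨φ, δ₀, hδ₀, hgap⟩ := hS
  exact ⟨δ₀, hδ₀, le_weilOddGroundEnergy_of_forall ha fun g hg hs hodd hn ↦
    hgap g hg hs hn (Or.inl hodd)⟩

/-- **The even bottom is the global bottom on a simple-even window**: `ε_ev(a) = ε(a)`
(`ε = min(ε_ev, ε_od)` and `ε < ε_od`). [folklore] -/
theorem weilEvenGroundEnergy_eq_of_simpleEven {a : ℝ} (ha : 0 < a) (hS : WeilWindowSimpleEven a) :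
    weilEvenGroundEnergy a = weilGroundEnergy a := by
  obtain ⟨δ₀, hδ₀, hgap⟩ := exists_gap_of_simpleEven ha hS
  have hmin := weilGroundEnergy_eq_min_even_odd a
  rcases le_total (weilEvenGroundEnergy a) (weilOddGroundEnergy a) with h | h
  · rw [hmin, min_eq_left h]
  · rw [min_eq_right h] at hmin
    linarith

/-- **Strict parity order on a simple-even window**: `ε_ev(a) < ε_od(a)`. [folklore] -/
theorem weilEvenGroundEnergy_lt_odd_of_simpleEven {a : ℝ} (ha : 0 < a)
    (hS : WeilWindowSimpleEven a) : weilEvenGroundEnergy a < weilOddGroundEnergy a := by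
  obtain ⟨δ₀, hδ₀, hgap⟩ := exists_gap_of_simpleEven ha hS
  rw [weilEvenGroundEnergy_eq_of_simpleEven ha hS]
  linarith

/-- **Stub 2 — ORDER ⇒ MATCHING at one window** (`a > 0`): if `ε_ev(a) ≤ ε_od(a)` then every odd
normalised test `o` on `[-a, a]` is matched up to any `δ > 0` by an even normalised test `e` with
`Re Q(e) ≤ Re Q(o) + δ` (`ε_od(a) ≤ Re Q(o)` and `ε_ev(a)` is the infimum of the nonempty even
sphere, `weilWindowSphereValues_even_nonempty`). [folklore] -/
theorem stub_evenWinsAt_of_le :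
    ∀ a : ℝ, 0 < a → weilEvenGroundEnergy a ≤ weilOddGroundEnergy a →
      ∀ o : ℝ → ℂ, IsWeilTest o → tsupport o ⊆ Set.Icc (-a) a → (∀ t, o (-t) = -o t) →
        ∫ t, ‖o t‖ ^ 2 = (1 : ℝ) → ∀ δ : ℝ, 0 < δ → ∃ e : ℝ → ℂ, IsWeilTest e ∧
          tsupport e ⊆ Set.Icc (-a) a ∧ (∀ t, e (-t) = e t) ∧ ∫ t, ‖e t‖ ^ 2 = (1 : ℝ) ∧
          (weilQuadratic e).re ≤ (weilQuadratic o).re + δ := by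
  intro a ha hle o ho hos hodd hon δ hδ
  have hle' : weilEvenGroundEnergy a ≤ (weilQuadratic o).re :=
    hle.trans (weilOddGroundEnergy_le ho hos hodd hon)
  have hne := weilWindowSphereValues_even_nonempty ha
  have hlt : sInf (weilWindowSphereValues (fun g ↦ ∀ t, g (-t) = g t) a) <
      weilEvenGroundEnergy a + δ := by
    rw [← weilEvenGroundEnergy_eq_sInf]
    linarith
  obtain ⟨x, hx, hxlt⟩ := exists_lt_of_csInf_lt hne hlt
  obtain ⟨e, he, hes, hev, hen, rfl⟩ := hx
  exact ⟨e, he, hes, hev, hen, by linarith⟩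

/-- **The strict order of the sector bottoms on every prime-free window**: `ε_ev(a) < ε_od(a)` for
`0 < a ≤ (log 2)/2` (stub 1 + the halving step). Also the anchor the route's beyond-arch items
(`OnePrimeWindowSimpleEven`, `NoParityCrossing`) propagate from. [folklore] -/
theorem weilEvenGroundEnergy_lt_odd_arch {a : ℝ} (ha : 0 < a) (hle : a ≤ Real.log 2 / 2) :
    weilEvenGroundEnergy a < weilOddGroundEnergy a :=
  weilEvenGroundEnergy_lt_odd_of_simpleEven ha (stub_archWindowsSimpleEven a ha hle)

/-! ## The skeleton theorem: the crux BY NAME (sorry-free) -/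

/-- **THE LINE CLOSES THE CRUX.** `EvenWinsArch` from the two stubs (both proved in this file):
the window clause on every archimedean window (the sibling's tree theorem, through the strict
order `weilEvenGroundEnergy_lt_odd_arch`) and the order-to-matching glue. Axioms: propext,
Classical.choice, Quot.sound. [folklore] -/
theorem EvenWinsArch_of : EvenWinsArch := by
  intro a ha hle o ho hos hodd hon δ hδ
  exact stub_evenWinsAt_of_le a ha (weilEvenGroundEnergy_lt_odd_arch ha hle).le o ho hos hodd hon δ hδ

end Summit.RiemannHypothesis.RiemannHypothesis.Cruxes.EvenWinsArch.SimpleEvenHalving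

end
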